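import Summits.ABC.IUTFork.Thm311Dictionary
import Literature.IUT.LogThetaLattice.TensorPackets
import Mathlib.LinearAlgebra.PiTensorProduct.Basic
import Mathlib.LinearAlgebra.Pi
import Mathlib.LinearAlgebra.Multilinear.Basic
import HarnessLib

/-!
# [J-III] §9.4 — Joshi's construction of Mochizuki's TENSOR-PACKET codomain `𝓘_Mochizuki ⊂ 𝓘^ℚ_Mochizuki`, I
# (block E of the abc-iut cell, rung LADDER-ABC:A2.E, slot T-20 = seat abc-iut-E-t20; dictionary row D-09)

Record-only typing (D-0012) of K. Joshi, *Construction of Arithmetic Teichmüller Spaces III*, arXiv:2401.13508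
**v4** (unrefereed "Preliminary version for comments"; bib `Joshi2024ATS3`; render `HOME/lit/renders/
Joshi-arxiv-2401.13508/pNNNN.txt`, cited "p.N l.a–b" = PDF page, lines of that render), §9.4 "Construction of
Mochizuki's Tensor Packet codomain `𝓘_Mochizuki` (resp. `𝓘^ℚ_Mochizuki`) for `Θ̃^𝓘_Mochizuki`", pp. 100–107. THIS
FILE: §9.4.1–9.4.7 and Def. 9.4.11.1 (Def. 9.4.2.3, Prop. 9.4.2.4, §9.4.5 + Lem. 9.4.5.1, (9.4.6.1)–(9.4.6.8) = Def.
9.4.6.7, (9.4.7.1)) and the dictionary row D-09 of plan/E/E-PLAN.md §3; the sequel `TensorPacketsJoshiCodomains`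
types Rmk. 9.4.6.9, §9.4.8–9.4.10 (`𝓘_Joshi`, Rmk. 9.4.8.2, Prop. 9.4.9.3, (9.4.10.1)). TAKES NO SIDE on [IUTchIII]
Cor. 3.12, on Joshi's claims, or on Mochizuki's report on them (`Mochizuki2024JoshiReport`); typed ≠ proved;
typed AS A CANDIDATE ≠ endorsed. Cell framing: locates / conditionally verifies; NO abc claim.

HOW IT IS TYPED. §9.4 is multilinear algebra over (a) the index data "`V_{L'} ⊃ V ≃ V_{L_mod}`" (§3.1/§3.3), the
primes `p`, `V_p = {w ∈ V : w | p}` (p.100 l.37–39), `ℓ* = (ℓ−1)/2`, and Mochizuki's capsule index sets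
`S_{j+1} = {0,…,j}`, `0 ≤ j ≤ ℓ*` (§9.4.5) — typed BY NAME by OUR `Thm311.ThetaIndex` (`V`, `VQ`, `over`,
`Fibre p` = `V_p`, `Label = {0,…,ℓ*}`, `Caps j` = `S_{j+1}` VERBATIM, `selfIndex j` = §9.4.9's "(j+1)th factor of
`S_{j+1}`", `LabelStar = {1,…,ℓ*}`); and (b) for every arithmeticoid `y` ([J-II½]) and `w ∈ V` the log-shell
`𝓘(L'_w)_y = H^1_e(G_{L'_w;K_{y_w}}, ℤ_p(1))` inside `𝓘^{ℚ_p}(L'_w)_y = H^1_e(…, ℚ_p(1))` ((9.4.1.1); §9.1–9.2 =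
slot T-19) — an UNBUNDLED carrier family `IQ : 𝔇.Arith → T.V → Type` of `𝕜`-modules with additive subgroups
`I y w` (no Galois cohomology is constructed; nothing about it is assumed). Over these, Joshi's `𝓘_p(L')`,
`^{S_{j+1}}𝓘_p(L')`, `𝓘_Mochizuki ⊂ 𝓘^ℚ_Mochizuki`, `𝓘̃_Mochizuki` and the maps `∏ → ⊗` are REAL objects (Mathlib
`PiTensorProduct`) built from OUR landed [IUTchIII] Prop. 3.2 typing `Literature.IUT.LogThetaLattice.MPacketN` /
`shellPacketN` BY NAME, so that row D-09 is KERNEL-DEFINITIONAL (§9, `packetQ_ofLogShells`, `rfl`; twin of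
`Cor312.packet_eq_mpacketN`): under Joshi's own strictification (9.4.8.3)/(9.4.9.2) "forgetting the `y_j` …
altogether (as [Mochizuki, 2021a,b,c] does)" (p.105 l.65–66), `^{S_{j+1}}𝓘^{ℚ_p}_p(L')` at `(j, p)` IS
`Thm311.LogShells.Packet j p`, the carrier `S.L.Packet j vQ` of the residual S = `Cor312Vol.PilotKummerIndRelated`.
What strictification forgets — the "valuation scaling property … crucial for establishing [Cor. 3.12]" (Rmk.
9.4.8.2) — is E-PLAN §2's load-bearing question for E-cx; it is named in the sequel, not adjudicated.

DERIVED (proved over the signature): Prop. 9.4.2.4 (1) (`regroup`, `regroup_mem_iff`); Lem. 9.4.5.1; (9.4.6.5)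
(`prodToPacket_mem`). Prop. 9.4.2.4 (2)–(4) (res / cores / local degrees, asserted in print) is typed as a
HYPOTHESIS in the sequel (`CoresResDegree`). The tag word "disputed" is the registered status word recording
that a dispute about the paper exists in print (`Mochizuki2024JoshiReport`); it takes no side.

FAITHFULNESS FLAGS (for E-ref). (F1) Print names no base ring for "⊗" in (9.4.6.1)–(9.4.6.2): typed over a field
`𝕜` (`ℚ` for our S-side packets, [IUTchIII] Rmk. 3.1.1 (i); `ℚ_p` for (9.4.10.1)'s "direct sum of p-adic fields").
(F2) The `ℤ_p`-level `⊗_{a∈A} 𝓘_p(L')` and its "⊂" ((9.4.6.8)) = Mochizuki's `𝓘(^A𝒟^⊢_{v_ℚ})`: the subgroup of the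
`𝕜`-level packet generated by pure tensors of shell elements (`shellPacketN`, [IUTchIII] Prop. 3.2 (ii)). (F3)
(9.4.6.5)/(9.4.6.6) "canonical homomorphism given by the construction of tensor products" `∏_a → ⊗_a` is the
canonical MULTILINEAR map `PiTensorProduct.tprod` (not additive). (F4) `j`-ranges: §9.4.6 prints "`1 ≤ j ≤ ℓ − 1`",
§9.4.5 has `0 ≤ j ≤ ℓ*`, (9.4.6.8) takes `∏_{j=1}^{ℓ*}`: packets are typed for every `j : T.Label`, the products over
`T.LabelStar` (S quantifies over all `j : T.Label`). (F5) Def. 9.4.11.1's sentence "If one wants to emphasize the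
role of the choice of the arithmeticoids … then I will write this as" ends without the notation in v4 (p.107
l.17–19); recorded, not repaired. (F6) §4.5 (p.36 l.13–17) has `z_Θ = (y_1,…,y_{ℓ*})` "such that `y_{ℓ*} = y'_0`",
§9.4.4 (p.102 l.22–28) the associated `ℓ*+1`-tuple `z_Θ = (y'_0, y'_1, …, y'_{ℓ*})`: here `z_Θ : T.Label → Arith`
is §9.4.4's tuple and "`y_j`" (`j ≥ 1`) its `j`-th entry; identifications with §4.4's `y'_0` belong to slot T-08.
Topologies (Def. 9.4.11.1 "induced from adeles") are not modelled (cf. `Thm311Sig`, `TensorPackets`; slot T-23).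
INTERIM CARRIER RULE (plan/E/ASSIGNMENTS.md §0.3) merge-debt: `IQ`/`I` = slot T-19 (`LogShellsJoshi`);
`Arith`/`ansatzGraph`/`zTheta` = slots T-07/T-08 ([J-III] §4) and E-t1 ([J-II½] arithmeticoids); res/cores data
of Prop. 9.4.2.4 = slot T-21. Deliberately NOT here: `Θ̃^𝓘` (§9.8, T-22), §9.5–9.7 (T-21), §9.9–9.10 (T-23), any
TEST against S (this block is a codomain; it claims nothing about pilot objects), any judgement.
-/

noncomputable section

namespace Summit.ABC.IUTFork.Joshi

open Thm311 Literature.IUT.LogThetaLattice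
open scoped TensorProduct

variable {T : ThetaIndex}

/-! ## 0. The inputs §9.4 fixes: arithmeticoid tuples and the standard point (interim carrier) -/

/-- INTERIM CARRIER for [J-III] §9.4 (index part): the arithmeticoids and the `ℓ*+1`-tuples §9.4.4–9.4.6 work
with. §9.4.4 (p.102 l.12–28): "instead of working with `z = (z_1,…,z_{ℓ*}) ∈ Σ̃_{L'}` one works with the `ℓ*+1`-tuple
`(z_0, z_1, …, z_{ℓ*})` where `z_0 ↦ (z_1,…,z_{ℓ*})` is the correspondence on `𝒴_{L'}` giving rise to `Σ̃_{L'}`. Notably,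
if `z_Θ` is the standard point §4.5 of `Σ̃_{L'}`, then one has the `ℓ*+1`-tuple `z_Θ = (y'_0, y'_1, …, y'_{ℓ*})`."
Tuples are indexed by OUR `T.Label = {0,…,ℓ*}`; the log-shell carriers are NOT fields (unbundled `IQ`, module
docstring). Merge-debt: `Arith` = E-t1 / [J-II½]; `ansatzGraph`, `zTheta` = slots T-07/T-08 ([J-III] §4.2–4.5).
[claim: Joshi2024ATS3, status: disputed] -/
structure TensorPacketDatum (T : ThetaIndex) where
  /-- the arithmeticoids `arith(L')_y`, i.e. the points `y ∈ 𝒴'_{L'}` ([J-III] §4.1; [J-II½] Def. 5.1.1) — abstract -/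
  Arith : Type
  /-- the graph of the correspondence `z_0 ↦ (z_1,…,z_{ℓ*})` giving Mochizuki's Adelic Ansatz `Σ̃_{L'}` (§9.4.4,
  p.102 l.12–22): the set of `ℓ*+1`-tuples `z = (z_0, z_1, …, z_{ℓ*})` "arising from `(z_1,…,z_{ℓ*}) ∈ Σ̃_{L'}`" -/
  ansatzGraph : Set (T.Label → Arith)
  /-- the `ℓ*+1`-tuple `z_Θ = (y'_0, y'_1, …, y'_{ℓ*})` of the standard point of Mochizuki's Ansatz (§9.4.4,
  p.102 l.22–28; §4.5, p.36 l.11–17: "a standard Θ-Link (for the purposes of [Mochizuki, 2021a,b,c])") -/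
  zTheta : T.Label → Arith
  /-- `z_Θ` is one of these tuples (§9.4.4, p.102 l.22–28) -/
  zTheta_mem : zTheta ∈ ansatzGraph

/-- The label `ℓ* ∈ {1,…,ℓ*}` (nonzero as `ℓ* ≥ 2`): the index of the entry "`y_{ℓ*}`" of `z_Θ` singled out by §4.5
("`y_{ℓ*} = y'_0`", p.36 l.13–17) and Rmk. 9.4.8.2 / Prop. 9.4.9.3 ("`𝓘_{p,y_j} ≃ 𝓘_{p,y_{ℓ*}}`"). [folklore] -/
def lstarLabel (T : ThetaIndex) : T.LabelStar :=
  ⟨Fin.last T.lstar, by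
    intro h
    have h' := congrArg Fin.val h
    rw [Fin.val_last, Fin.val_zero] at h'
    have := T.two_le_lstar
    omega⟩

namespace TensorPacketDatum

variable (𝔇 : TensorPacketDatum T)

/-! ## 1. §9.4.5: Mochizuki's procession — the sets `S_{j+1}(z) = {z_0,…,z_j}` and Lemma 9.4.5.1 -/

/-- The arithmeticoid `z_a`, `a ∈ S_{j+1} = {0,1,…,j}`, of an `ℓ*+1`-tuple `z` (§9.4.5, p.102 l.35–41: "for each
`j = 0,1,…,ℓ*`, the sets `S_j(z) = {z_0, z_1, …, z_j}`"); `S_{j+1}` is OUR `T.Caps j = Fin (j+1)` ([IUTchI] Prop.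
6.9 (i) "`S^±_{j+1} = {0,…,j}`") verbatim. [claim: Joshi2024ATS3, status: disputed] -/
def capsEntry (z : T.Label → 𝔇.Arith) (j : T.Label) (a : T.Caps j) : 𝔇.Arith :=
  z ⟨a.1, by have := a.2; have := j.2; omega⟩

/-- The "`(j+1)`th factor of `S_{j+1}`" (§9.4.9, p.106 l.21–27), i.e. the index `j ∈ S_{j+1} = {0,…,j}` — OUR
`ThetaIndex.selfIndex j` — picks out the entry `z_j` itself. [folklore] -/
theorem capsEntry_selfIndex (z : T.Label → 𝔇.Arith) (j : T.Label) : 𝔇.capsEntry z j (T.selfIndex j) = z j := rfl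

/-- `S_j(z) = {z_0, z_1, …, z_j}` as a SET of arithmeticoids (§9.4.5, p.102 l.37–38), for the label `j`
(index set `S_{j+1}` = `T.Caps j`). [claim: Joshi2024ATS3, status: disputed] -/
def capsSet (z : T.Label → 𝔇.Arith) (j : T.Label) : Set 𝔇.Arith := Set.range (𝔇.capsEntry z j)

/-- `S⋇_j(z) = {z_1, …, z_j}` (§9.4.5, p.102 l.32–34, l.39–41: "`S⋇_{j+1} = {1,…,j}` … has exactly `j` elements").
[claim: Joshi2024ATS3, status: disputed] -/
def capsStarSet (z : T.Label → 𝔇.Arith) (j : T.Label) : Set 𝔇.Arith :=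
  𝔇.capsEntry z j '' {a : T.Caps j | (a : ℕ) ≠ 0}

/-- [J-III] Lemma 9.4.5.1, first chain (p.103 l.7–10): "`S_0(z) = {z_0} ⊂ S_1(z) = {z_0,z_1} ⊂ ⋯ ⊂ S_{ℓ*}(z)`" —
monotonicity in the label, PROVED ("an elementary consequence", p.103 l.6). [claim: Joshi2024ATS3, status: disputed] -/
theorem capsSet_mono (z : T.Label → 𝔇.Arith) {j j' : T.Label} (h : j ≤ j') : 𝔇.capsSet z j ⊆ 𝔇.capsSet z j' := by
  rintro x ⟨a, rfl⟩
  have ha := a.2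
  have hj : (j : ℕ) ≤ (j' : ℕ) := h
  exact ⟨⟨a.1, by omega⟩, rfl⟩

/-- Lemma 9.4.5.1, first term (p.103 l.10): `S_0(z) = {z_0}`. [claim: Joshi2024ATS3, status: disputed] -/
theorem capsSet_zero (z : T.Label → 𝔇.Arith) : 𝔇.capsSet z 0 = {z 0} := by
  ext x
  constructor
  · rintro ⟨a, rfl⟩
    have ha : (a : ℕ) = 0 := by have := a.2; simp only [Fin.val_zero] at this; omega
    show z _ = z 0
    congr 1
    exact Fin.ext (by simp only [Fin.val_zero]; exact ha)
  · rintro rfl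
    exact ⟨⟨0, Nat.succ_pos _⟩, rfl⟩

/-- Lemma 9.4.5.1, last term (p.103 l.1–2, l.10): `S_{ℓ*}(z) = {z_0, z_1, …, z_{ℓ*}}` is the set of ALL entries.
[claim: Joshi2024ATS3, status: disputed] -/
theorem capsSet_last (z : T.Label → 𝔇.Arith) : 𝔇.capsSet z (Fin.last T.lstar) = Set.range z := by
  ext x
  constructor
  · rintro ⟨a, rfl⟩
    exact ⟨_, rfl⟩
  · rintro ⟨i, rfl⟩
    have hi := i.2
    exact ⟨⟨i.1, by simp only [Fin.val_last]; omega⟩, rfl⟩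

/-- Lemma 9.4.5.1, second chain (p.103 l.11–15): "`S⋇_1(z) = {z_1} ⊂ S⋇_2(z) = {z_1,z_2} ⊂ ⋯ ⊂ S⋇_{ℓ*}(z)`",
PROVED. [claim: Joshi2024ATS3, status: disputed] -/
theorem capsStarSet_mono (z : T.Label → 𝔇.Arith) {j j' : T.Label} (h : j ≤ j') :
    𝔇.capsStarSet z j ⊆ 𝔇.capsStarSet z j' := by
  rintro x ⟨a, ha0, rfl⟩
  have ha := a.2
  have hj : (j : ℕ) ≤ (j' : ℕ) := h
  exact ⟨⟨a.1, by omega⟩, ha0, rfl⟩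

/-- `S⋇_j(z) ⊆ S_j(z)` (§9.4.5: `S⋇_{j+1} = {1,…,j} ⊂ S_{j+1} = {0,…,j}`). [folklore] -/
theorem capsStarSet_subset_capsSet (z : T.Label → 𝔇.Arith) (j : T.Label) :
    𝔇.capsStarSet z j ⊆ 𝔇.capsSet z j :=
  Set.image_subset_range _ _

/-! ## 2. §9.4.1–9.4.2: the local packets `𝓘_p(L') ⊂ 𝓘^{ℚ_p}_p(L')` and the adelic `H^1_e` (Def. 9.4.2.3) -/

section Carriers

variable (𝕜 : Type) [Field 𝕜]
variable (IQ : 𝔇.Arith → T.V → Type) [∀ y w, AddCommGroup (IQ y w)] [∀ y w, Module 𝕜 (IQ y w)]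
variable (I : ∀ (y : 𝔇.Arith) (w : T.V), AddSubgroup (IQ y w))

/-- `𝓘^{ℚ_p}_p(L')_y = ⊕_{w ∈ V_p} 𝓘^{ℚ_p}(L'_w)_y` ((9.4.1.3), p.100 l.45–57; `= ∏_{w∈V_p}` in (9.4.2.2), p.101
l.9–15: "finite direct products and finite direct sums coincide … write both of these multiplicatively"), for the
arithmeticoid `y`; "the product is over primes of `V` and not over all primes of `V_{L'}`" (p.100 l.53–55): `V_p` =
OUR `T.Fibre p`. Definitionally `Thm311.LogShells.Packet1 p` under §9. [claim: Joshi2024ATS3, status: disputed] -/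
abbrev localPacketQ (y : 𝔇.Arith) (p : T.VQ) : Type := ∀ w : T.Fibre p, IQ y w.1

/-- `𝓘_p(L')_y = ⊕_{w∈V_p} 𝓘(L'_w)_y ⊂ 𝓘^{ℚ_p}_p(L')_y` ((9.4.1.2), p.100 l.40–44; (9.4.2.1), p.101 l.3–7): the product of
the log-shells `𝓘(L'_w)_y = 𝓘(hol(X/L)_{y_w}) = H^1_e(G_{L'_w;K_{y_w}}, ℤ_p(1))` of (9.4.1.1) (p.100 l.23–36), as an
additive subgroup (= Literature `shellPacket1`). [claim: Joshi2024ATS3, status: disputed] -/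
def localPacket (y : 𝔇.Arith) (p : T.VQ) : AddSubgroup (𝔇.localPacketQ IQ y p) :=
  AddSubgroup.pi Set.univ fun w => I y w.1

/-- [J-III] Definition 9.4.2.3, rational version (p.101 l.20–32): "`H^1_e(arith(L'_{y_0}), ℚ(1))`", defined
"similarly" to the integral one — the product over ALL `w ∈ V` of the local `ℚ_p`-log-shells, for any
arithmeticoid `y` (Rmk. 9.4.11.2 (2)). [claim: Joshi2024ATS3, status: disputed] -/
abbrev adelicH1eQ (y : 𝔇.Arith) : Type := ∀ w : T.V, IQ y w

/-- [J-III] Definition 9.4.2.3, integral version (p.101 l.20–28):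
"`H^1_e(arith(L'_{y_0}), ℤ(1)) = ∏_{w∈V} H^1_e(arith(L'_{y_0})_w, ℤ(1))`", as an additive subgroup of the rational
one. [claim: Joshi2024ATS3, status: disputed] -/
def adelicH1e (y : 𝔇.Arith) : AddSubgroup (𝔇.adelicH1eQ IQ y) :=
  AddSubgroup.pi Set.univ fun w => I y w

/-- The property (9.4.1.3)/(9.2.1.3) print uses to DEFINE the rational shell: "`𝓘^{ℚ_p}_p(L')` is the `ℚ_p`-vector
space generated by each direct summand of `𝓘_p(L')`" (p.100 l.52–53), "`𝓘^{ℚ_p}(…) = 𝓘(…) ⊗_{ℤ_p} ℚ_p`" (p.96 l.51–52) —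
a NAMED property of the carriers (slot T-19 supplies it), not a field. [claim: Joshi2024ATS3, status: disputed] -/
def IsSpanOfShell : Prop := ∀ (y : 𝔇.Arith) (w : T.V), Submodule.span 𝕜 (I y w : Set (IQ y w)) = ⊤

/-- [J-III] Proposition 9.4.2.4 (1) (p.101 l.34–50): "for each choice of a bijection `V ≃ V_{L_mod}` … one has the
equality `H^1_e(arith(L')_{y_0}, ℚ(1)) = ∏_p 𝓘^{ℚ_p}_p = ∏_p ∏_{w∈V_p} 𝓘^{ℚ_p}(L'_w)`" — PROVED as the linear regrouping
of `∏_{w∈V}` along the fibres of `V → V_ℚ` (p.102 l.1–2). [claim: Joshi2024ATS3, status: disputed] -/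
def regroup (y : 𝔇.Arith) : 𝔇.adelicH1eQ IQ y ≃ₗ[𝕜] (∀ p : T.VQ, 𝔇.localPacketQ IQ y p) where
  toFun f p w := f w.1
  invFun g w := g (T.over w) (T.toFibre w)
  left_inv _ := rfl
  right_inv g := by
    funext p w
    obtain ⟨w, rfl⟩ := w
    rfl
  map_add' _ _ := rfl
  map_smul' _ _ := rfl

/-- The regrouping map of Prop. 9.4.2.4 (1) on components. [folklore] -/
@[simp] theorem regroup_apply (y : 𝔇.Arith) (f : 𝔇.adelicH1eQ IQ y) (p : T.VQ) (w : T.Fibre p) :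
    𝔇.regroup 𝕜 IQ y f p w = f w.1 := rfl

/-- The inverse regrouping map of Prop. 9.4.2.4 (1) on components. [folklore] -/
@[simp] theorem regroup_symm_apply (y : 𝔇.Arith) (g : ∀ p : T.VQ, 𝔇.localPacketQ IQ y p) (w : T.V) :
    (𝔇.regroup 𝕜 IQ y).symm g w = g (T.over w) (T.toFibre w) := rfl

/-- Prop. 9.4.2.4 (1) at the integral level: the regrouping carries `H^1_e(arith(L')_y, ℤ(1))` (Def. 9.4.2.3)
exactly onto `∏_p 𝓘_p(L')` (p.101 l.16–19: "useful in understanding `∏_p 𝓘_p` in terms of the cohomology of the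
standard arithmeticoid"). PROVED. [claim: Joshi2024ATS3, status: disputed] -/
theorem regroup_mem_iff (y : 𝔇.Arith) (f : 𝔇.adelicH1eQ IQ y) :
    (∀ p : T.VQ, 𝔇.regroup 𝕜 IQ y f p ∈ 𝔇.localPacket IQ I y p) ↔ f ∈ 𝔇.adelicH1e IQ I y := by
  simp only [localPacket, adelicH1e, AddSubgroup.mem_pi, Set.mem_univ, true_implies]
  constructor
  · intro h w
    exact h (T.over w) (T.toFibre w)
  · intro h p w
    exact h w.1

/-! ## 3. §9.4.6: tensor products of Mochizuki's log-shells over `S_{j+1}(z)` -/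

/-- The family `a ↦ (w ↦ 𝓘^{ℚ_p}(L'_w)_{z_a})`, `a ∈ S_{j+1}`, `w ∈ V_p`, fed to the Literature's `MPacketN` ([IUTchIII]
Prop. 3.2) with `A := S_{j+1}(z)`. [claim: Joshi2024ATS3, status: disputed] -/
abbrev capsFamily (z : T.Label → 𝔇.Arith) (j : T.Label) (p : T.VQ) : T.Caps j → T.Fibre p → Type :=
  fun a w => IQ (𝔇.capsEntry z j a) w.1

/-- `^{S_{j+1}}𝓘^{ℚ_p}_p(L') = ⊗_{a ∈ S_{j+1}(z)} 𝓘^{ℚ_p}_p(L') = ⊗_{a∈A} ( ⊕_{w∈V_p} 𝓘^{ℚ_p}(L'_w)_{z_a} )`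
((9.4.6.2), p.103 l.52–69; "Given `z = (z_0, …, z_{ℓ*}) ∈ 𝒴'_{L'}` and if `A` is one of the sets `S_{j+1}(z)` for
`1 ≤ j ≤ ℓ−1` [as printed]", p.103 l.33–36; typed for every label `j`, flag F4) — BY NAME the Literature's
mono-analytic tensor packet `MPacketN 𝕜` (flag F1). [claim: Joshi2024ATS3, status: disputed] -/
abbrev packetQ (z : T.Label → 𝔇.Arith) (j : T.Label) (p : T.VQ) : Type :=
  MPacketN 𝕜 (𝔇.capsFamily IQ z j p)

/-- `^{S_{j+1}}𝓘_p(L') = ⊗_{a∈S_{j+1}(z)} 𝓘_p(L') = ⊗_{a∈A} ( ⊕_{w∈V_p} 𝓘(L'_w)_{z_a} )` ((9.4.6.1), p.103 l.37–50)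
"`⊂`" `^{S_{j+1}}𝓘^{ℚ_p}_p(L')` ((9.4.6.8)): the additive subgroup generated by the pure tensors of shell
elements = Mochizuki's `𝓘(^A𝒟^⊢_{v_ℚ})`, the Literature's `shellPacketN` BY NAME (flag F2).
[claim: Joshi2024ATS3, status: disputed] -/
def packet (z : T.Label → 𝔇.Arith) (j : T.Label) (p : T.VQ) : AddSubgroup (𝔇.packetQ 𝕜 IQ z j p) :=
  shellPacketN 𝕜 (𝔇.capsFamily IQ z j p) fun a w => I (𝔇.capsEntry z j a) w.1

/-- The PRODUCT variant `^{S_{j+1}}𝓘̃^{ℚ_p}_p(L') = ∏_{a∈A} 𝓘^{ℚ_p}_p(L') = ∏_{a∈A} ( ⊕_{w∈V_p} 𝓘^{ℚ_p}(L'_w)_{z_a} )`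
((9.4.6.4), p.104 l.17–32: "it is also convenient to consider product versions instead of tensor products").
[claim: Joshi2024ATS3, status: disputed] -/
abbrev prodPacketQ (z : T.Label → 𝔇.Arith) (j : T.Label) (p : T.VQ) : Type :=
  ∀ a : T.Caps j, 𝔇.localPacketQ IQ (𝔇.capsEntry z j a) p

/-- `^{S_{j+1}}𝓘̃_p(L') = ∏_{a∈A} 𝓘_p(L')` ((9.4.6.3), p.104 l.3–16), inside the rational product variant.
[claim: Joshi2024ATS3, status: disputed] -/
def prodPacket (z : T.Label → 𝔇.Arith) (j : T.Label) (p : T.VQ) : AddSubgroup (𝔇.prodPacketQ IQ z j p) :=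
  AddSubgroup.pi Set.univ fun a => 𝔇.localPacket IQ I (𝔇.capsEntry z j a) p

/-- The canonical map `^{S_{j+1}}𝓘̃^{ℚ_p}_p(L') → ^{S_{j+1}}𝓘^{ℚ_p}_p(L')` of (9.4.6.6) (p.104 l.33–39: "canonical
homomorphism given by the construction of tensor products"): the canonical MULTILINEAR map `(x_a)_a ↦ ⊗_a x_a`
(flag F3); its restriction to `∏_a 𝓘_p(L')` is (9.4.6.5), `prodToPacket_mem`. [claim: Joshi2024ATS3, status: disputed] -/
def prodToPacket (z : T.Label → 𝔇.Arith) (j : T.Label) (p : T.VQ) :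
    MultilinearMap 𝕜 (fun a : T.Caps j => 𝔇.localPacketQ IQ (𝔇.capsEntry z j a) p) (𝔇.packetQ 𝕜 IQ z j p) :=
  PiTensorProduct.tprod 𝕜

/-- (9.4.6.5) (p.104 l.35): the canonical map carries `^{S_{j+1}}𝓘̃_p(L') = ∏_a 𝓘_p(L')` INTO
`^{S_{j+1}}𝓘_p(L') = ⊗_a 𝓘_p(L')` — PROVED (pure tensors of shell elements generate the latter). [folklore] -/
theorem prodToPacket_mem (z : T.Label → 𝔇.Arith) (j : T.Label) (p : T.VQ) (x : 𝔇.prodPacketQ IQ z j p)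
    (hx : x ∈ 𝔇.prodPacket IQ I z j p) :
    𝔇.prodToPacket 𝕜 IQ z j p x ∈ 𝔇.packet 𝕜 IQ I z j p := by
  refine AddSubgroup.subset_closure ⟨x, fun a => ?_, rfl⟩
  exact (AddSubgroup.mem_pi _).1 hx a (Set.mem_univ _)

/-! ## 4. Def. 9.4.6.7 / Def. 9.4.11.1: `𝓘_Mochizuki(L') ⊂ 𝓘^ℚ_Mochizuki(L')`; §9.4.7 product variants -/

/-- `𝓘^ℚ_Mochizuki(L') = ∏_p ( ∏_{j=1}^{ℓ*} ^{S_{j+1}}𝓘^{ℚ_p}_p(L') )` (Def. 9.4.6.7, (9.4.6.8), p.104 l.52–62), for the tuple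
`z` (Rmk. 9.4.11.2 (2): "also … for arbitrary `arith(L')_y`"); `j ∈ {1,…,ℓ*}` = OUR `T.LabelStar` (flag F4). Def.
9.4.11.1 (p.107 l.4–12): "equipped with the topology induced from adeles … Mochizuki's tensor product codomains
for the theta-values locus" — topology not modelled. Row D-09: at `(j, p)` this is our `S.L.Packet j p`
(`packetQ_ofLogShells`); E-plan's `Joshi.Dictionary.real : Move → S.L.PacketAut` acts on exactly this product of packets.
[claim: Joshi2024ATS3, status: disputed] -/
abbrev IQMochizukiAt (z : T.Label → 𝔇.Arith) : Type := ∀ (p : T.VQ) (j : T.LabelStar), 𝔇.packetQ 𝕜 IQ z j.1 p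

/-- MOCHIZUKI'S ADELIC TENSOR PRODUCT LOG-SHELL `𝓘_Mochizuki(L') = ∏_p ( ∏_{j=1}^{ℓ*} ^{S_{j+1}}𝓘_p(L') ) ⊂
𝓘^ℚ_Mochizuki(L')` ([J-III] Definition 9.4.6.7, (9.4.6.8), p.104 l.40–64: "the adelic product [Mochizuki, 2021c,
Theorem 3.11(i)(c)]"; Rmk. 9.4.11.2 (1), p.107 l.21–22: "This construction is carried out in [Mochizuki, 2021c,
Proposition 3.1] and `𝓘_Mochizuki` is called the holomorphic log-shell"), for the tuple `z`.
[claim: Joshi2024ATS3, status: disputed] -/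
def IMochizukiAt (z : T.Label → 𝔇.Arith) : AddSubgroup (𝔇.IQMochizukiAt 𝕜 IQ z) :=
  AddSubgroup.pi Set.univ fun p => AddSubgroup.pi Set.univ fun j => 𝔇.packet 𝕜 IQ I z j.1 p

/-- `𝓘^ℚ_Mochizuki(L')` ((9.4.6.8)) for the STANDARD tuple `z_Θ` of §9.4.4 — §9.4.1's reference arithmeticoids ("I
will drop the reference to the arithmeticoid … and simply write `𝓘(L'_w) = 𝓘(hol(X/L)_{z'_w})`", p.100 l.31–36).
[claim: Joshi2024ATS3, status: disputed] -/
abbrev IQMochizuki : Type := 𝔇.IQMochizukiAt 𝕜 IQ 𝔇.zTheta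

/-- `𝓘_Mochizuki(L') ⊂ 𝓘^ℚ_Mochizuki(L')` (Def. 9.4.6.7 / Def. 9.4.11.1) for the standard tuple `z_Θ`: "Mochizuki's
tensor product codomain for the theta-values locus" (p.107 l.10–12) — the named group slot T-22's
`Θ̃^𝓘_Mochizuki` lives in. [claim: Joshi2024ATS3, status: disputed] -/
def IMochizuki : AddSubgroup (𝔇.IQMochizuki 𝕜 IQ) := 𝔇.IMochizukiAt 𝕜 IQ I 𝔇.zTheta

/-- `𝓘̃^ℚ_Mochizuki = ∏_p ( ∏_{j=1}^{ℓ*} ^{S_{j+1}}𝓘̃^ℚ_p )` (§9.4.7, (9.4.7.1) right-hand side, p.105 l.1–22: "their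
product variants in the style of (9.4.6.3) and (9.4.6.4)"), for the tuple `z`; Def. 9.4.11.1: "Mochizuki's product
codomains for the theta-values locus" (p.107 l.7–11). [claim: Joshi2024ATS3, status: disputed] -/
abbrev prodIQMochizukiAt (z : T.Label → 𝔇.Arith) : Type :=
  ∀ (p : T.VQ) (j : T.LabelStar), 𝔇.prodPacketQ IQ z j.1 p

/-- `𝓘̃_Mochizuki = ∏_p ( ∏_{j=1}^{ℓ*} ^{S_{j+1}}𝓘̃_p ) ⊂ 𝓘̃^ℚ_Mochizuki` ((9.4.7.1), p.105 l.4–22), for the tuple `z`.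
[claim: Joshi2024ATS3, status: disputed] -/
def prodIMochizukiAt (z : T.Label → 𝔇.Arith) : AddSubgroup (𝔇.prodIQMochizukiAt IQ z) :=
  AddSubgroup.pi Set.univ fun p => AddSubgroup.pi Set.univ fun j => 𝔇.prodPacket IQ I z j.1 p

/-- The map `𝓘̃^ℚ_Mochizuki → 𝓘^ℚ_Mochizuki` (§9.4.7, p.105 l.23–29: "obtained using the natural homomorphism given
by the tensor product construction"; Def. 9.4.11.1, p.107 l.13–16), componentwise `prodToPacket` (flag F3).
[claim: Joshi2024ATS3, status: disputed] -/
def prodToIQMochizukiAt (z : T.Label → 𝔇.Arith) (x : 𝔇.prodIQMochizukiAt IQ z) : 𝔇.IQMochizukiAt 𝕜 IQ z :=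
  fun p j => 𝔇.prodToPacket 𝕜 IQ z j.1 p (x p j)

/-- `𝓘̃_Mochizuki → 𝓘_Mochizuki` (§9.4.7, p.105 l.23–24): the map carries the integral product variant into the
integral tensor variant — PROVED. [folklore] -/
theorem prodToIQMochizukiAt_mem (z : T.Label → 𝔇.Arith) (x : 𝔇.prodIQMochizukiAt IQ z)
    (hx : x ∈ 𝔇.prodIMochizukiAt IQ I z) :
    𝔇.prodToIQMochizukiAt 𝕜 IQ z x ∈ 𝔇.IMochizukiAt 𝕜 IQ I z := by
  simp only [prodIMochizukiAt, IMochizukiAt, AddSubgroup.mem_pi, Set.mem_univ, true_implies] at hx ⊢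
  exact fun p j => 𝔇.prodToPacket_mem 𝕜 IQ I z j.1 p (x p j) (hx p j)

end Carriers

/-! ## 5. Dictionary row D-09: Joshi's packets ARE our tensor packets under the strictification -/

/-- The STRICTIFICATION dictionary (E-PLAN §3 row D-09; Joshi (9.4.8.3)/(9.4.9.2), p.105 l.57–66: "forgetting the
`y_j` (or any arithmeticoids giving rise to a specific log-shell) altogether (as [Mochizuki, 2021a,b,c] does)"):
read `𝓘^{ℚ_p}(L'_w)_y` as OUR strictified carrier `log(𝒟^⊢_w)` of `L : Thm311.LogShells T`, independently of `y`.
OUR READING (a map, not a claim); the forgotten `y`-dependence is Rmk. 9.4.8.2's valuation scaling. [folklore] -/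
abbrev ofLogShells (𝔇 : TensorPacketDatum T) (L : LogShells T) : 𝔇.Arith → T.V → Type := fun _ w => L.carrier w

/-- D-09, local level: under the strictification Joshi's `𝓘^{ℚ_p}_p(L')_y = ⊕_{w∈V_p} 𝓘^{ℚ_p}(L'_w)` ((9.4.1.3)) IS
our 1-tensor packet `log(𝒟^⊢_{v_ℚ}) = Thm311.LogShells.Packet1 p`, definitionally. [folklore] -/
theorem localPacketQ_ofLogShells (L : LogShells T) (y : 𝔇.Arith) (p : T.VQ) :
    𝔇.localPacketQ (𝔇.ofLogShells L) y p = L.Packet1 p := rfl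

/-- **D-09, packet level**: under the strictification Joshi's `^{S_{j+1}}𝓘^{ℚ_p}_p(L')` ((9.4.6.2)) at `(j, p)` —
the `(p, j)`-factor of `𝓘^ℚ_Mochizuki(L')` ((9.4.6.8)) — IS our `(j+1)`-tensor packet
`Thm311.LogShells.Packet j p = 𝓘^ℚ(^{S^±_{j+1}}𝒟^⊢_{v_ℚ})`, the carrier `S.L.Packet j vQ` over which the residual
sentence S = `Cor312Vol.PilotKummerIndRelated` quantifies; definitionally (twin of `Cor312.packet_eq_mpacketN`).
[folklore] -/
theorem packetQ_ofLogShells (L : LogShells T) (z : T.Label → 𝔇.Arith) (j : T.Label) (p : T.VQ) :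
    𝔇.packetQ ℚ (𝔇.ofLogShells L) z j p = L.Packet j p := rfl

/-- D-09, codomain level: under the strictification `𝓘^ℚ_Mochizuki(L')` IS the product over `p` and `j ∈ {1,…,ℓ*}`
of our tensor packets (flag F4: S also has the label `j = 0`). [folklore] -/
theorem IQMochizukiAt_ofLogShells (L : LogShells T) (z : T.Label → 𝔇.Arith) :
    𝔇.IQMochizukiAt ℚ (𝔇.ofLogShells L) z = ∀ (p : T.VQ) (j : T.LabelStar), L.Packet j.1 p := rfl

/-- D-09, regions: the per-packet SHADOWS of a subset `X ⊆ 𝓘^ℚ_Mochizuki(L')` (e.g. slot T-22's `Θ̃^𝓘_Mochizuki`,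
§9.8): its images under the coordinate projections to the packets `(p, j)` — under the strictification, families
of regions `Set (L.Packet j p)`, the type of `ρ qK j vQ` / `ρ D'.Ψ j vQ` compared by S (OUR READING; E-PLAN rows
D-11/D-12 are stated over it by T-22 / E-cx, not here). [folklore] -/
def packetShadows {𝕜 : Type} [Field 𝕜] {IQ : 𝔇.Arith → T.V → Type} [∀ y w, AddCommGroup (IQ y w)]
    [∀ y w, Module 𝕜 (IQ y w)] {z : T.Label → 𝔇.Arith} (X : Set (𝔇.IQMochizukiAt 𝕜 IQ z))
    (p : T.VQ) (j : T.LabelStar) : Set (𝔇.packetQ 𝕜 IQ z j.1 p) :=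
  (fun x => x p j) '' X

/-- Shadows are monotone in the subset. [folklore] -/
theorem packetShadows_mono {𝕜 : Type} [Field 𝕜] {IQ : 𝔇.Arith → T.V → Type} [∀ y w, AddCommGroup (IQ y w)]
    [∀ y w, Module 𝕜 (IQ y w)] {z : T.Label → 𝔇.Arith} {X Y : Set (𝔇.IQMochizukiAt 𝕜 IQ z)} (h : X ⊆ Y)
    (p : T.VQ) (j : T.LabelStar) : 𝔇.packetShadows X p j ⊆ 𝔇.packetShadows Y p j :=
  Set.image_mono h

end TensorPacketDatum

end Summit.ABC.IUTFork.Joshi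

end
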